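import Literature.NumberTheory.Kottwitz1992.FixedPointCount
import HarnessLib

/-!
# Discharges for the carpet `Kottwitz1992/FixedPointCount` (§16)

`Kottwitz1992_16_heckeCosetCount_holds` (ED. 1), `Kottwitz1992_16_orbitalIntegral_hecke_holds` (ED. 2).

Topic `Literature/NumberTheory/Kottwitz1992`; namespace `Literature.NumberTheory.Kottwitz1992.FixedPointCountHolds`
(squad TK ruling 2026-09-02T02:29Z: carpets stay statements-only; every `_holds` of a carpet's CLOSED facts goes into
the sibling proof-lane file `<Section>Holds.lean`). PROOFS ONLY: no definition, no new named fact, no `sorry`, no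
`axiom`, no `instance`, no `notation`.

* `Kottwitz1992_16_heckeCosetCount_holds : FixedPointCount.Kottwitz1992_16_heckeCosetCount` — the coset count behind
  «It is easy to check that `O_γ(f̃^p) = O_γ(f^p)`» [Kottwitz1992, §16 p. 432]: for a subgroup `K`, `g`, `z`, the
  condition `z k ∈ K g⁻¹` (`⟺ z k g ∈ K`) is invariant under `k ↦ k c`, `c ∈ K_g = K ∩ gKg⁻¹`; for `z = k₁ g⁻¹ k₂`
  the coset of `k₂⁻¹` satisfies it and any other solution `k' ∈ K` has `k₂ k' ∈ K_g`; and `z k ∈ K g⁻¹` for some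
  `k ∈ K` forces `z ∈ K g⁻¹ K`. Elementary group theory (two private membership lemmas).

* `Kottwitz1992_16_orbitalIntegral_hecke_holds : FixedPointCount.Kottwitz1992_16_orbitalIntegral_hecke` (ED. 2) —
  «It is easy to check that `O_γ(f̃^p) = O_γ(f^p)`» on ONE invariant measure [Kottwitz1992, §16 p. 432]:
  `O_γ^m(𝟙_{K g⁻¹ K}) = [K : K_g] · O_γ^m(𝟙_{K g⁻¹})` for `K` compact open and `m` invariant; both sides are real
  measures of pull-backs along `y ↦ y γ y⁻¹`, and `π⁻¹(K g⁻¹ K)` is the disjoint union of the `[K : K_g] < ∞`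
  translates of `π⁻¹(K g⁻¹)` indexed by `K/K_g` (the coset count above), each of the same measure.

With ED. 2 every CLOSED named fact of the carpet `FixedPointCount` is discharged; the remaining named facts of §16 are
predicates on the posited datum `FixedPointData` (letters V1, not dischargeable in-model).

## References
* R. E. Kottwitz, *Points on some Shimura varieties over finite fields*, J. Amer. Math. Soc. 5 (1992): §16 p. 432.
  [Kottwitz1992]
-/

open scoped Pointwise

namespace Literature.NumberTheory.Kottwitz1992.FixedPointCountHolds

open Literature.NumberTheory.Kottwitz1992.FixedPointCount

universe u

/-- `x ∈ S · {a} ↔ x a⁻¹ ∈ S` in a group. [folklore] -/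
private theorem mem_mul_singleton_iff_mul_inv_mem {G : Type*} [Group G] (S : Set G) (a x : G) :
    x ∈ S * {a} ↔ x * a⁻¹ ∈ S := by
  rw [Set.mul_singleton, Set.mem_image]
  constructor
  · rintro ⟨s, hs, rfl⟩; simpa using hs
  · intro h; exact ⟨x * a⁻¹, h, by simp⟩

/-- `c ∈ K ∩ gKg⁻¹ ↔ c ∈ K ∧ g⁻¹ c g ∈ K`. [folklore] -/
private theorem mem_inf_map_conj_iff {G : Type*} [Group G] (K : Subgroup G) (g c : G) :
    c ∈ K ⊓ K.map (MulAut.conj g).toMonoidHom ↔ c ∈ K ∧ g⁻¹ * c * g ∈ K := by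
  rw [Subgroup.mem_inf, Subgroup.mem_map]
  constructor
  · rintro ⟨hc, k, hk, rfl⟩
    refine ⟨hc, ?_⟩
    simpa [MulAut.conj_apply, mul_assoc] using hk
  · rintro ⟨hc, h⟩
    refine ⟨hc, g⁻¹ * c * g, h, ?_⟩
    simp [MulAut.conj_apply, mul_assoc]

/-- **Discharge** of `FixedPointCount.Kottwitz1992_16_heckeCosetCount` (the coset count behind «It is easy to check
that `O_γ(f̃^p) = O_γ(f^p)`»): `z k ∈ K g⁻¹ ↔ z k g ∈ K`; for `z = k₁ g⁻¹ k₂` the coset of `k₂⁻¹` works and any other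
solution `k'` has `k₂ k' ∈ K ∩ gKg⁻¹`; conversely `z k ∈ K g⁻¹` forces `z ∈ K g⁻¹ K`. [cite: Kottwitz1992, §16 (p. 432)] -/
theorem Kottwitz1992_16_heckeCosetCount_holds : Kottwitz1992_16_heckeCosetCount.{u} := by
  intro G _ K g z
  have key : ∀ x : G, x ∈ (K : Set G) * {g⁻¹} ↔ x * g ∈ K := fun x => by
    rw [mem_mul_singleton_iff_mul_inv_mem, inv_inv]; rfl
  refine ⟨?_, ?_, ?_⟩
  · intro k c hk hc
    rw [mem_inf_map_conj_iff] at hc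
    rw [key, key]
    have h1 : z * (k * c) * g = (z * k * g) * (g⁻¹ * c * g) := by group
    rw [h1]
    constructor
    · intro h; exact K.mul_mem h hc.2
    · intro h
      have h5 : z * k * g = z * k * g * (g⁻¹ * c * g) * (g⁻¹ * c * g)⁻¹ := by group
      rw [h5]
      exact K.mul_mem h (K.inv_mem hc.2)
  · intro hz
    obtain ⟨y, hy, k₂, hk₂, rfl⟩ := Set.mem_mul.1 hz
    obtain ⟨k₁, hk₁, a, ha, rfl⟩ := Set.mem_mul.1 hy
    rw [Set.mem_singleton_iff] at ha
    subst ha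
    refine ⟨k₂⁻¹, K.inv_mem hk₂, ?_, ?_⟩
    · rw [key]
      have h2 : k₁ * g⁻¹ * k₂ * k₂⁻¹ * g = k₁ := by group
      rw [h2]; exact hk₁
    · intro k' hk' hzk'
      rw [key] at hzk'
      rw [inv_inv, mem_inf_map_conj_iff]
      refine ⟨K.mul_mem hk₂ hk', ?_⟩
      have h3 : g⁻¹ * (k₂ * k') * g = k₁⁻¹ * (k₁ * g⁻¹ * k₂ * k' * g) := by group
      rw [h3]
      exact K.mul_mem (K.inv_mem hk₁) hzk'
  · intro hz k hk hzk
    apply hz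
    rw [key] at hzk
    have h4 : z = (z * k * g) * g⁻¹ * k⁻¹ := by group
    rw [h4]
    exact Set.mul_mem_mul (Set.mul_mem_mul hzk (Set.mem_singleton _)) (K.inv_mem hk)

/-! ## `O_γ(𝟙_{K g⁻¹ K}) = [K : K_g] · O_γ(𝟙_{K g⁻¹})` — discharge of `Kottwitz1992_16_orbitalIntegral_hecke`

ED. 2 (TK-t07 g2, 2026-09-02; append-only below ED. 1). The printed «It is easy to check that `O_γ(f̃^p) = O_γ(f^p)`»
[Kottwitz1992, §16 p. 432] on ONE invariant measure `m` on `G ⧸ C(γ)`: writing `π : y C(γ) ↦ y γ y⁻¹` and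
`Ũ = π⁻¹(K g⁻¹)`, `U = π⁻¹(K g⁻¹ K)`, both orbital integrals are the (real) `m`-measures of `Ũ`, `U` (indicators of
open sets pulled back along the continuous `π`), and `U = ⨆_{k K_g ∈ K/K_g} k • Ũ` is a DISJOINT union of
`[K : K_g] < ∞` translates of `Ũ` (the coset count `Kottwitz1992_16_heckeCosetCount_holds` above: `y γ y⁻¹ ∈ K g⁻¹ K`
iff exactly one coset `k K_g` has `k⁻¹ (y γ y⁻¹) k ∈ K g⁻¹`, i.e. `k⁻¹ • y ∈ Ũ`), each of measure `m(Ũ)` by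
invariance; `K/K_g` is finite because `K` is compact and `K_g = K ∩ g K g⁻¹` is open. No integrability hypothesis is
needed: both sides are `toReal` of measures (junk `0` at `∞` on both sides consistently). -/

section OrbitalHecke

open _root_.MeasureTheory
open scoped ENNReal
open Literature.MeasureTheory.Group
open Literature.NumberTheory.Automorphic (orbitalIntegral orbitalIntegral_eq_integral_descConj)

/-- For `k ∈ K`: `k⁻¹ z k ∈ K g⁻¹ ↔ z k ∈ K g⁻¹` (`K g⁻¹` is stable under left multiplication by `K`). [folklore] -/
private theorem conj_mem_mul_singleton_iff {G : Type*} [Group G] (K : Subgroup G) (g z : G) {k : G}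
    (hk : k ∈ K) : k⁻¹ * z * k ∈ (K : Set G) * {g⁻¹} ↔ z * k ∈ (K : Set G) * {g⁻¹} := by
  rw [mem_mul_singleton_iff_mul_inv_mem, mem_mul_singleton_iff_mul_inv_mem, inv_inv]
  constructor
  · intro h
    have h1 : z * k * g = k * (k⁻¹ * z * k * g) := by group
    rw [h1]
    exact K.mul_mem hk h
  · intro h
    have h1 : k⁻¹ * z * k * g = k⁻¹ * (z * k * g) := by group
    rw [h1]
    exact K.mul_mem (K.inv_mem hk) h

/-- `K_g = K ∩ g K g⁻¹` is open when `K` is (it is `K ∩ (c ↦ g⁻¹ c g)⁻¹(K)`). [folklore] -/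
private theorem isOpen_inf_map_conj {G : Type*} [Group G] [TopologicalSpace G] [IsTopologicalGroup G]
    (K : Subgroup G) (g : G) (hK : IsOpen (K : Set G)) :
    IsOpen ((K ⊓ K.map (MulAut.conj g).toMonoidHom : Subgroup G) : Set G) := by
  have h : ((K ⊓ K.map (MulAut.conj g).toMonoidHom : Subgroup G) : Set G) =
      (K : Set G) ∩ (fun c => g⁻¹ * c * g) ⁻¹' (K : Set G) := by
    ext c
    simp only [Set.mem_inter_iff, Set.mem_preimage, SetLike.mem_coe]
    exact mem_inf_map_conj_iff K g c
  rw [h]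
  exact hK.inter (hK.preimage (by fun_prop))

/-- `K / K_g` is finite for `K` compact open (compact and discrete). [folklore] -/
private theorem finite_quotient_inf_map_conj {G : Type*} [Group G] [TopologicalSpace G]
    [IsTopologicalGroup G] (K : Subgroup G) (g : G) (hKo : IsOpen (K : Set G))
    (hKc : IsCompact (K : Set G)) :
    Finite (K ⧸ (K ⊓ K.map (MulAut.conj g).toMonoidHom).subgroupOf K) := by
  haveI : CompactSpace K := isCompact_iff_compactSpace.mp hKc
  have hopen : IsOpen (((K ⊓ K.map (MulAut.conj g).toMonoidHom).subgroupOf K : Subgroup K) : Set K) :=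
    (isOpen_inf_map_conj K g hKo).preimage continuous_subtype_val
  haveI : DiscreteTopology (K ⧸ (K ⊓ K.map (MulAut.conj g).toMonoidHom).subgroupOf K) :=
    QuotientGroup.discreteTopology hopen
  exact finite_of_compact_of_discrete

/-- **Discharge** of `FixedPointCount.Kottwitz1992_16_orbitalIntegral_hecke` («It is easy to check that
`O_γ(f̃^p) = O_γ(f^p)`» on one invariant measure): `O_γ^m(𝟙_{K g⁻¹ K}) = [K : K_g] · O_γ^m(𝟙_{K g⁻¹})` for `K`
compact open, `K_g = K ∩ g K g⁻¹`, `m` a `G`-invariant Borel measure on `G ⧸ C(γ)`. Proof: both sides are real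
measures of the pull-backs `U = π⁻¹(K g⁻¹ K)`, `Ũ = π⁻¹(K g⁻¹)` along `π : y ↦ y γ y⁻¹`, and `U` is the disjoint
union of the `[K : K_g]` translates `k • Ũ`, `k K_g ∈ K / K_g` (coset count `Kottwitz1992_16_heckeCosetCount_holds`),
all of measure `m(Ũ)`. [cite: Kottwitz1992, §16 (p. 432)] -/
theorem Kottwitz1992_16_orbitalIntegral_hecke_holds : Kottwitz1992_16_orbitalIntegral_hecke.{u} := by
  intro G _ _ _ γ _ _ m _ K g hKo hKc
  -- the orbital map `π : y C(γ) ↦ y γ y⁻¹` (the `descConj` of `id`), continuous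
  obtain ⟨π, hπ⟩ : ∃ π : G ⧸ Subgroup.centralizer ({γ} : Set G) → G,
      π = descConj γ (Subgroup.centralizer ({γ} : Set G))
        (fun _ hg => Subgroup.mem_centralizer_singleton_iff.1 hg) id := ⟨_, rfl⟩
  have hπc : Continuous π := hπ ▸ continuous_descConj γ _ _ continuous_id
  have hπ_mk : ∀ x : G, π (QuotientGroup.mk x) = x * γ * x⁻¹ := fun x => by rw [hπ]; rfl
  -- Step 1: the orbital integral of the indicator of an open `S ⊆ G` is the real measure of `π⁻¹(S)`
  have hOI : ∀ S : Set G, IsOpen S →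
      orbitalIntegral γ (S.indicator (1 : G → ℝ)) m = m.real (π ⁻¹' S) := by
    intro S hS
    rw [orbitalIntegral_eq_integral_descConj, descConj_eq_comp, ← hπ,
      ← integral_indicator_one ((hS.preimage hπc).measurableSet)]
    congr 1
  -- the finite quotient `K / K_g` and representatives
  set Kg : Subgroup G := K ⊓ K.map (MulAut.conj g).toMonoidHom with hKg
  haveI : Finite (K ⧸ Kg.subgroupOf K) := finite_quotient_inf_map_conj K g hKo hKc
  letI : Fintype (K ⧸ Kg.subgroupOf K) := Fintype.ofFinite _
  obtain ⟨rep, hrep⟩ : ∃ rep : K ⧸ Kg.subgroupOf K → G, rep = fun q => ((Quotient.out q : K) : G) :=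
    ⟨_, rfl⟩
  have rep_mem : ∀ q, rep q ∈ K := fun q => by rw [hrep]; exact (Quotient.out q).2
  have rep_rel : ∀ k : K, (k : G)⁻¹ * rep (QuotientGroup.mk k) ∈ Kg := fun k => by
    have h := QuotientGroup.eq.mp (QuotientGroup.out_eq' (QuotientGroup.mk (s := Kg.subgroupOf K) k)).symm
    rw [Subgroup.mem_subgroupOf, Subgroup.coe_mul, Subgroup.coe_inv] at h
    rw [hrep]
    exact h
  -- the two pulled-back sets
  obtain ⟨Ut, hUt⟩ : ∃ Ut : Set (G ⧸ Subgroup.centralizer ({γ} : Set G)),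
      Ut = π ⁻¹' ((K : Set G) * {g⁻¹}) := ⟨_, rfl⟩
  have hUt_meas : MeasurableSet Ut := hUt ▸ ((hKo.mul_right).preimage hπc).measurableSet
  -- Step 2: membership in a translate `k • Ũ`, `k ∈ K`, is the coset condition `(x γ x⁻¹) k ∈ K g⁻¹`
  have hmemT : ∀ (k x : G), k ∈ K →
      ((QuotientGroup.mk x : G ⧸ Subgroup.centralizer ({γ} : Set G)) ∈ k • Ut ↔
        x * γ * x⁻¹ * k ∈ (K : Set G) * {g⁻¹}) := by
    intro k x hk
    rw [Set.mem_smul_set_iff_inv_smul_mem, MulAction.Quotient.smul_mk, smul_eq_mul, hUt, Set.mem_preimage,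
      hπ_mk, show k⁻¹ * x * γ * (k⁻¹ * x)⁻¹ = k⁻¹ * (x * γ * x⁻¹) * k by group]
    exact conj_mem_mul_singleton_iff K g _ hk
  -- Step 3: `π⁻¹(K g⁻¹ K)` is the union of the translates `rep q • Ũ` …
  have hU_eq : π ⁻¹' ((K : Set G) * {g⁻¹} * (K : Set G)) = ⋃ q, rep q • Ut := by
    ext y
    obtain ⟨x, rfl⟩ := QuotientGroup.mk_surjective y
    rw [Set.mem_iUnion, Set.mem_preimage, hπ_mk]
    obtain ⟨h1, h2, h3⟩ := Kottwitz1992_16_heckeCosetCount_holds G K g (x * γ * x⁻¹)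
    constructor
    · intro hz
      obtain ⟨k, hk, hPk, -⟩ := h2 hz
      refine ⟨QuotientGroup.mk ⟨k, hk⟩, ?_⟩
      rw [hmemT _ _ (rep_mem _)]
      have h := (h1 k (k⁻¹ * rep (QuotientGroup.mk ⟨k, hk⟩)) hk (rep_rel ⟨k, hk⟩)).1 hPk
      rwa [mul_inv_cancel_left] at h
    · rintro ⟨q, hq⟩
      rw [hmemT _ _ (rep_mem q)] at hq
      by_contra hz
      exact h3 hz _ (rep_mem q) hq
  -- … and the translates are pairwise disjoint
  have hdisj : Pairwise (Function.onFun Disjoint fun q => rep q • Ut) := by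
    intro q q' hne
    refine Set.disjoint_left.2 fun y hy hy' => hne ?_
    obtain ⟨x, rfl⟩ := QuotientGroup.mk_surjective y
    obtain ⟨-, h2, h3⟩ := Kottwitz1992_16_heckeCosetCount_holds G K g (x * γ * x⁻¹)
    rw [hmemT _ _ (rep_mem q)] at hy
    rw [hmemT _ _ (rep_mem q')] at hy'
    have hz : x * γ * x⁻¹ ∈ (K : Set G) * {g⁻¹} * (K : Set G) := by
      by_contra hz
      exact h3 hz _ (rep_mem q) hy
    obtain ⟨k, -, -, huniq⟩ := h2 hz
    have ha : k⁻¹ * rep q ∈ Kg := huniq _ (rep_mem q) hy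
    have hb : k⁻¹ * rep q' ∈ Kg := huniq _ (rep_mem q') hy'
    have hab : (rep q)⁻¹ * rep q' ∈ Kg := by
      have h := Kg.mul_mem (Kg.inv_mem ha) hb
      rwa [show (k⁻¹ * rep q)⁻¹ * (k⁻¹ * rep q') = (rep q)⁻¹ * rep q' by group] at h
    have h := QuotientGroup.eq.mpr
      (show (Quotient.out q : K)⁻¹ * Quotient.out q' ∈ Kg.subgroupOf K by
        rw [Subgroup.mem_subgroupOf, Subgroup.coe_mul, Subgroup.coe_inv, hrep] at *
        exact hab)
    rwa [QuotientGroup.out_eq', QuotientGroup.out_eq'] at h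
  -- Step 4: `m(π⁻¹(K g⁻¹ K)) = [K : K_g] · m(Ũ)`
  have hmU : m (π ⁻¹' ((K : Set G) * {g⁻¹} * (K : Set G))) = (Kg.relIndex K : ℝ≥0∞) * m Ut := by
    rw [hU_eq, measure_iUnion hdisj fun q => hUt_meas.const_smul (rep q)]
    simp_rw [measure_smul]
    rw [tsum_fintype, Finset.sum_const, Finset.card_univ, nsmul_eq_mul, ← Nat.card_eq_fintype_card]
    rfl
  -- assembly
  rw [hOI _ (hKo.mul_right.mul_right), hOI _ hKo.mul_right, ← hUt, measureReal_def, measureReal_def, hmU,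
    ENNReal.toReal_mul, ENNReal.toReal_natCast]

end OrbitalHecke

end Literature.NumberTheory.Kottwitz1992.FixedPointCountHolds
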